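import Summits.Ventures.YMGap.Conjectures.StrongCouplingChiralLROMesonWeightBackground
import HarnessLib
import HarnessLib.Audit.Tags

/-!
# Lattice symmetries of the meson moments (2a/2): coordinate permutations of the torus act on gauge
# fields preserving `∏dU` and the Wilson plaquette action

Cell `pub-ymgap`, seat qcd-lit g21 (literature-prover), `bears_on: Q1`.  Everything is a theorem
(0 facts, 0 sorry).  Pure-gauge half of the discharge of hypothesis `hP` of `…MesonWeightAllPlanes`.

A permutation `σ` of the `ν` coordinate axes acts on sites (`coordPerm σ : x ↦ x ∘ σ`), on links
(`edgePerm σ : (x, μ) ↦ (x ∘ σ, σ⁻¹μ)`, so that `x + e_μ ↦ x∘σ + e_{σ⁻¹μ}`) and on gauge fields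
(`configPerm σ U = U ∘ (edgePerm σ)⁻¹`, a measurable equivalence).  **`∏dU` is invariant**
(`measurePreserving_configPerm`) and **the Wilson action of `U(N)` is invariant** (`wilsonAction_configPerm`):
the plaquette holonomies are carried to plaquette holonomies (`plaquetteHolonomy_configPerm`), possibly
with the orientation reversed, which inverts the holonomy and does not change `Re tr` (the action is
rewritten as half the sum over ORDERED pairs of distinct directions, `wilsonAction_eq_half_sum`).

Honest framing: finite torus `(ℤ/Lℤ)^ν`, `G = U(N)` in the defining representation; nothing about the
continuum or the summit's `QCD` conjunct.

## References
* [SalmhoferSeiler1991] M. Salmhofer, E. Seiler, Commun. Math. Phys. 139 (1991) 395–432, §2 (2.2), (2.12).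
* [MontvayMunster1994] I. Montvay, G. Münster, *Quantum Fields on a Lattice*, CUP 1994, §3.2 (lattice
  symmetries of the Wilson action).
-/

noncomputable section

open MeasureTheory Finset
open scoped BigOperators Matrix
open Literature.MathematicalPhysics.QuantumFieldTheory (Site Edge GaugeConfig Plaquette plaquetteHolonomy wilsonAction
  haarProbability)
open Literature.MathematicalPhysics.QuantumLattice
open Literature.Probability.LatticeModels (TorusSite)

namespace Summit.Ventures.YMGap.Conjectures

namespace MesonWeight

open SchwingerDyson

variable {N ν L : ℕ}

/-! ### Coordinate permutations acting on sites, links and gauge fields -/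

/-- The action of a permutation `σ` of the axes on sites, `x ↦ x ∘ σ`. [cite: MontvayMunster1994, §3.2] -/
def coordPerm (σ : Equiv.Perm (Fin ν)) : TorusSite ν L ≃ TorusSite ν L where
  toFun x := x ∘ σ
  invFun x := x ∘ σ.symm
  left_inv x := by funext j; simp
  right_inv x := by funext j; simp

/-- `coordPerm` pointwise. [cite: MontvayMunster1994, §3.2] -/
@[simp] theorem coordPerm_apply (σ : Equiv.Perm (Fin ν)) (x : TorusSite ν L) (j : Fin ν) : coordPerm σ x j = x (σ j) := rfl

/-- The inverse of `coordPerm σ` is `coordPerm σ⁻¹`. [cite: MontvayMunster1994, §3.2] -/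
theorem coordPerm_symm (σ : Equiv.Perm (Fin ν)) : (coordPerm (L := L) σ).symm = coordPerm σ.symm := rfl

/-- `e_μ ∘ σ = e_{σ⁻¹ μ}`. [cite: MontvayMunster1994, §3.2] -/
theorem single_comp_perm (σ : Equiv.Perm (Fin ν)) (μ : Fin ν) :
    ((Pi.single μ (1 : ZMod L) : TorusSite ν L) ∘ σ) = Pi.single (σ.symm μ) 1 := by
  funext j
  simp only [Function.comp_apply, Pi.single_apply, Equiv.apply_eq_iff_eq_symm_apply]

/-- `(x + e_μ) ∘ σ = x ∘ σ + e_{σ⁻¹μ}`. [cite: MontvayMunster1994, §3.2] -/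
theorem coordPerm_add_single (σ : Equiv.Perm (Fin ν)) (x : TorusSite ν L) (μ : Fin ν) :
    coordPerm σ (x + Pi.single μ 1) = coordPerm σ x + Pi.single (σ.symm μ) 1 := by
  show (x + Pi.single μ 1) ∘ σ = x ∘ σ + Pi.single (σ.symm μ) 1
  rw [← single_comp_perm]; rfl

/-- `coordPerm σ` on `x.shift μ`. [cite: MontvayMunster1994, §3.2] -/
theorem coordPerm_shift (σ : Equiv.Perm (Fin ν)) (x : TorusSite ν L) (μ : Fin ν) :
    coordPerm σ (Site.shift x μ) = Site.shift (coordPerm σ x) (σ.symm μ) :=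
  coordPerm_add_single σ x μ

/-- The action on links: `(x, μ) ↦ (x ∘ σ, σ⁻¹ μ)` (the link from `x∘σ` to `(x + e_μ)∘σ`). [cite: MontvayMunster1994, §3.2] -/
def edgePerm (σ : Equiv.Perm (Fin ν)) : Edge ν L ≃ Edge ν L where
  toFun e := (coordPerm σ e.1, σ.symm e.2)
  invFun e := (coordPerm σ.symm e.1, σ e.2)
  left_inv e := by
    obtain ⟨x, μ⟩ := e
    simp only [Prod.mk.injEq]
    exact ⟨funext fun j => by simp, σ.apply_symm_apply μ⟩
  right_inv e := by
    obtain ⟨x, μ⟩ := e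
    simp only [Prod.mk.injEq]
    exact ⟨funext fun j => by simp, σ.symm_apply_apply μ⟩

/-- `edgePerm` pointwise. [cite: MontvayMunster1994, §3.2] -/
@[simp] theorem edgePerm_apply (σ : Equiv.Perm (Fin ν)) (e : Edge ν L) : edgePerm σ e = (coordPerm σ e.1, σ.symm e.2) := rfl

/-- The inverse link map. [cite: MontvayMunster1994, §3.2] -/
@[simp] theorem edgePerm_symm_apply (σ : Equiv.Perm (Fin ν)) (e : Edge ν L) :
    (edgePerm σ).symm e = (coordPerm σ.symm e.1, σ e.2) := rfl

variable (N) in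
/-- The action on gauge fields, `U ↦ U ∘ (edgePerm σ)⁻¹`, as a measurable equivalence. [cite: MontvayMunster1994, §3.2] -/
def configPerm (σ : Equiv.Perm (Fin ν)) : GaugeConfig ν L (UN N) ≃ᵐ GaugeConfig ν L (UN N) :=
  MeasurableEquiv.arrowCongr' (edgePerm σ) (MeasurableEquiv.refl (UN N))

/-- `configPerm` pointwise. [cite: MontvayMunster1994, §3.2] -/
theorem configPerm_apply (σ : Equiv.Perm (Fin ν)) (U : GaugeConfig ν L (UN N)) (e : Edge ν L) :
    configPerm N σ U e = U ((edgePerm σ).symm e) := rfl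

/-- The permuted field on the image link is the original link variable. [cite: MontvayMunster1994, §3.2] -/
theorem configPerm_apply_edgePerm (σ : Equiv.Perm (Fin ν)) (U : GaugeConfig ν L (UN N)) (e : Edge ν L) :
    configPerm N σ U (edgePerm σ e) = U e := by
  rw [configPerm_apply, Equiv.symm_apply_apply]

/-- **`∏dU` is invariant under coordinate permutations.** [cite: SalmhoferSeiler1991, §2 (2.12)] -/
theorem measurePreserving_configPerm [NeZero L] (σ : Equiv.Perm (Fin ν)) :
    MeasurePreserving (configPerm N σ) (haarPi N ν L) (haarPi N ν L) :=
  measurePreserving_arrowCongr' (fun _ : Edge ν L => haarProbability (UN N)) (fun _ => haarProbability (UN N))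
    (edgePerm σ) (MeasurableEquiv.refl _) fun _ => MeasurePreserving.id _

/-! ### The Wilson action is invariant under coordinate permutations -/

/-- The plaquette holonomies of the permuted field are the holonomies of the original field at the
permuted plaquette. [cite: MontvayMunster1994, §3.2] -/
theorem plaquetteHolonomy_configPerm (σ : Equiv.Perm (Fin ν)) (U : GaugeConfig ν L (UN N)) (y : TorusSite ν L)
    (a b : Fin ν) :
    plaquetteHolonomy (configPerm N σ U) y a b = plaquetteHolonomy U (coordPerm σ.symm y) (σ a) (σ b) := by
  simp only [plaquetteHolonomy, configPerm_apply, edgePerm_symm_apply, coordPerm_shift, Equiv.symm_symm]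

/-- Reversing the orientation of a plaquette inverts its holonomy. [cite: MontvayMunster1994, §3.2] -/
theorem plaquetteHolonomy_swap {G : Type*} [Group G] (U : GaugeConfig ν L G) (x : TorusSite ν L) (a b : Fin ν) :
    plaquetteHolonomy U x b a = (plaquetteHolonomy U x a b)⁻¹ := by
  simp only [plaquetteHolonomy, mul_inv_rev, inv_inv, mul_assoc]

/-- The plaquette cost `N - Re tr U_p` of `U(N)` is orientation independent (`Re tr U⁻¹ = Re tr U`). [cite: MontvayMunster1994, §3.2] -/
theorem plaqCost_inv (h : UN N) :
    (N : ℝ) - ((unitaryFundamentalRep (Fin N) ℂ) h⁻¹).trace.re = (N : ℝ) - ((unitaryFundamentalRep (Fin N) ℂ) h).trace.re := by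
  show (N : ℝ) - ((h⁻¹ : UN N) : Matrix (Fin N) (Fin N) ℂ).trace.re = (N : ℝ) - ((h : Matrix (Fin N) (Fin N) ℂ)).trace.re
  rw [Matrix.UnitaryGroup.inv_val, Matrix.star_eq_conjTranspose, Matrix.trace_conjTranspose, Complex.star_def,
    Complex.conj_re]

/-- **The Wilson action as half the sum over ordered pairs of distinct directions.** [cite: MontvayMunster1994, §3.2] -/
theorem wilsonAction_eq_half_sum [NeZero L] (U : GaugeConfig ν L (UN N)) :
    wilsonAction (unitaryFundamentalRep (Fin N) ℂ) U =
      (1 / 2 : ℝ) * ∑ x : TorusSite ν L, ∑ a : Fin ν, ∑ b : Fin ν,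
        if a = b then 0 else ((N : ℝ) - ((unitaryFundamentalRep (Fin N) ℂ) (plaquetteHolonomy U x a b)).trace.re) := by
  classical
  set F : TorusSite ν L → Fin ν → Fin ν → ℝ :=
    fun x a b => (N : ℝ) - ((unitaryFundamentalRep (Fin N) ℂ) (plaquetteHolonomy U x a b)).trace.re with hF
  have hsym : ∀ x a b, F x b a = F x a b := fun x a b => by
    simp only [hF, plaquetteHolonomy_swap U x a b, plaqCost_inv]
  -- the plaquette sum as a sum over sites and increasing pairs
  have hP : wilsonAction (unitaryFundamentalRep (Fin N) ℂ) U =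
      ∑ x : TorusSite ν L, ∑ p : {p : Fin ν × Fin ν // p.1 < p.2}, F x p.1.1 p.1.2 := by
    rw [wilsonAction, Fintype.sum_prod_type]
  rw [hP, Finset.mul_sum]
  refine Finset.sum_congr rfl fun x _ => ?_
  -- ordered pairs: `a ≠ b` splits into `a < b` and `b < a`
  have hlt : ∑ p : {p : Fin ν × Fin ν // p.1 < p.2}, F x p.1.1 p.1.2 =
      ∑ p ∈ (Finset.univ : Finset (Fin ν × Fin ν)).filter (fun p => p.1 < p.2), F x p.1 p.2 := by
    exact (Finset.sum_subtype _ (fun p => by simp) (fun p : Fin ν × Fin ν => F x p.1 p.2)).symm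
  have hgt : ∑ p ∈ (Finset.univ : Finset (Fin ν × Fin ν)).filter (fun p => p.2 < p.1), F x p.1 p.2 =
      ∑ p ∈ (Finset.univ : Finset (Fin ν × Fin ν)).filter (fun p => p.1 < p.2), F x p.1 p.2 := by
    refine Finset.sum_nbij' Prod.swap Prod.swap (fun p hp => ?_) (fun p hp => ?_) (fun _ _ => rfl) (fun _ _ => rfl)
      (fun p _ => hsym x p.2 p.1)
    · simp only [Finset.mem_filter, Finset.mem_univ, true_and] at hp ⊢; exact hp
    · simp only [Finset.mem_filter, Finset.mem_univ, true_and] at hp ⊢; exact hp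
  have hne : ∑ a : Fin ν, ∑ b : Fin ν, (if a = b then 0 else F x a b) =
      ∑ p ∈ (Finset.univ : Finset (Fin ν × Fin ν)).filter (fun p => p.1 < p.2), F x p.1 p.2 +
        ∑ p ∈ (Finset.univ : Finset (Fin ν × Fin ν)).filter (fun p => p.2 < p.1), F x p.1 p.2 := by
    rw [← Finset.sum_product' (f := fun a b => if a = b then (0 : ℝ) else F x a b), Finset.univ_product_univ,
      ← Finset.sum_filter_add_sum_filter_not Finset.univ (fun p : Fin ν × Fin ν => p.1 < p.2)]
    congr 1
    · exact Finset.sum_congr rfl fun p hp => by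
        rw [Finset.mem_filter] at hp; rw [if_neg (ne_of_lt hp.2)]
    · rw [← Finset.sum_filter_add_sum_filter_not ((Finset.univ : Finset (Fin ν × Fin ν)).filter fun p => ¬ p.1 < p.2)
        (fun p : Fin ν × Fin ν => p.2 < p.1), Finset.filter_filter, Finset.filter_filter]
      have h1 : (Finset.univ : Finset (Fin ν × Fin ν)).filter (fun p => ¬ p.1 < p.2 ∧ p.2 < p.1) =
          Finset.univ.filter (fun p => p.2 < p.1) := by
        ext p; simp only [Finset.mem_filter, Finset.mem_univ, true_and]; constructor
        · exact fun h => h.2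
        · exact fun h => ⟨not_lt.2 h.le, h⟩
      have h2 : ∑ p ∈ (Finset.univ : Finset (Fin ν × Fin ν)).filter (fun p => ¬ p.1 < p.2 ∧ ¬ p.2 < p.1),
          (if p.1 = p.2 then (0 : ℝ) else F x p.1 p.2) = 0 :=
        Finset.sum_eq_zero fun p hp => by
          rw [Finset.mem_filter] at hp
          rw [if_pos (le_antisymm (not_lt.1 hp.2.2) (not_lt.1 hp.2.1))]
      rw [h1, h2, add_zero]
      exact Finset.sum_congr rfl fun p hp => by
        rw [Finset.mem_filter] at hp; rw [if_neg (ne_of_gt hp.2)]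
  rw [hne, hgt, hlt]
  ring

/-- Relabelling both directions of an ordered-pair sum by a permutation. [cite: MontvayMunster1994, §3.2] -/
theorem sum_pairs_perm (σ : Equiv.Perm (Fin ν)) (g : Fin ν → Fin ν → ℝ) :
    (∑ a : Fin ν, ∑ b : Fin ν, if a = b then (0 : ℝ) else g (σ a) (σ b)) =
      ∑ a : Fin ν, ∑ b : Fin ν, if a = b then (0 : ℝ) else g a b := by
  rw [show (∑ a : Fin ν, ∑ b : Fin ν, if a = b then (0 : ℝ) else g (σ a) (σ b)) =
      ∑ a : Fin ν, ∑ b : Fin ν, if σ a = σ b then (0 : ℝ) else g (σ a) (σ b) by simp only [Equiv.apply_eq_iff_eq]]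
  exact (Equiv.sum_comp σ (fun a' => ∑ b : Fin ν, if a' = σ b then (0 : ℝ) else g a' (σ b))).trans
    (Finset.sum_congr rfl fun a' _ => Equiv.sum_comp σ (fun b' => if a' = b' then (0 : ℝ) else g a' b'))

/-- **THE WILSON ACTION OF `U(N)` IS INVARIANT UNDER COORDINATE PERMUTATIONS.** [cite: MontvayMunster1994, §3.2] -/
theorem wilsonAction_configPerm [NeZero L] (σ : Equiv.Perm (Fin ν)) (U : GaugeConfig ν L (UN N)) :
    wilsonAction (unitaryFundamentalRep (Fin N) ℂ) (configPerm N σ U) = wilsonAction (unitaryFundamentalRep (Fin N) ℂ) U := by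
  rw [wilsonAction_eq_half_sum, wilsonAction_eq_half_sum]
  refine congrArg (fun t : ℝ => (1 / 2 : ℝ) * t) ?_
  simp only [plaquetteHolonomy_configPerm]
  exact (Finset.sum_congr rfl fun y _ => sum_pairs_perm σ
      (fun a b => (N : ℝ) - ((unitaryFundamentalRep (Fin N) ℂ) (plaquetteHolonomy U (coordPerm σ.symm y) a b)).trace.re)).trans
    (Equiv.sum_comp (coordPerm (L := L) σ.symm) fun x => ∑ a : Fin ν, ∑ b : Fin ν,
      if a = b then (0 : ℝ) else ((N : ℝ) - ((unitaryFundamentalRep (Fin N) ℂ) (plaquetteHolonomy U x a b)).trace.re))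

/-- The plaquette Boltzmann factor is invariant under coordinate permutations. [cite: SalmhoferSeiler1991, §2 (2.2)] -/
theorem plaq_configPerm [NeZero L] (σ : Equiv.Perm (Fin ν)) (β : ℝ) (U : GaugeConfig ν L (UN N)) :
    plaq N ν L β (configPerm N σ U) = plaq N ν L β U := by
  rw [plaq, plaq, wilsonAction_configPerm]

end MesonWeight

end Summit.Ventures.YMGap.Conjectures

end
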